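import Mathlib
import HarnessLib
import Summits.QuantumAdvantage.QuantumAdvantage.Theorems.DigitDialA
import Summits.QuantumAdvantage.AdviceFreeQNC0.HiddenCoinsReduction
import Summits.QuantumAdvantage.AdviceFreeQNC0.WalkTubeRank
import Literature.Computability.Complexity.GabberGalil
import Summits.QuantumAdvantage.QuantumAdvantage.Theorems.CharDialUnreadTwist
import Summits.QuantumAdvantage.AdviceFreeQNC0.PredHard

set_option linter.dupNamespace false
set_option autoImplicit false

/-!
# DigitDial (B) — WEIGHT-RESIDUE strategies lose the u-walk game (cell decomp-qadv, lens 4, g20)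

Prop-definition-free tree twin of §2–§3 of the lens-4 g20 node `DigitDial`.  A WEIGHT-RESIDUE STRATEGY reads the input
`u ∈ {0,1}ⁿ` only through its Hamming weight modulo `M`: `wStrat h g u = h g (wres M u)`, `wres M u = |u| mod M`, with an
arbitrary table `h : Fin (n+1) → ℤ/M → Bool`.
* §2 `card_win_wStrat_le` — for `3 ∤ M` and `n ≥ 4`, every charge `c` and every table,
  `#{u : ringWinU c (wStrat h) u} ≤ (3/4 + 3M·cos(π/(3M))ⁿ)·2ⁿ`: decompose by the residue `m = |u| mod M` (on each fibre the
  strategy is the CONSTANT firing set `{g : h g m}`), expand the fibre indicator in additive characters of `ℤ/M`, bound the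
  trivial character by the hidden-coins constant `3/4` (`hiddenCoinsFour`) and each twisted term by `DigitDialA`
  (`TwistM.corr_win_weight_le`).
* §3 `card_win_wStrat_le_polylog` — `θ = 7/8` for all `0 < M ≤ (log₂ n)^C` coprime to `3`, `n ≥ n₀(C)` (the twist term is
  `≤ 1/8` because `cos(π/3M) ≤ 1 − 1/(4M²)` and `M² = o(n)`; `TubePlanProof.logPow_le_natSqrt`).
The hypothesis `3 ∤ M` is necessary: `DigitDialC.wStrat_easyTable_perfect`.
0 sorry; axioms standard; no `instance`, no `notation`, no `native_decide`; no `def … : Prop`.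
-/

noncomputable section

namespace Summit.QuantumAdvantage.QuantumAdvantage.Theorems.DigitDial

open Finset Summit.QuantumAdvantage.AdviceFreeQNC0 Literature.Computability.MetaComplexity
open TwistedTransfer ConstBells

/-! ## §2  Weight-residue strategies: `y_g(u) = h_g(|u| mod M)` -/

section WeightResidue

variable {n : ℕ} {M : ℕ} [NeZero M]

/-- The Hamming weight of the input as a residue mod `M`: `|u| mod M = Σ_i [u_i]`. -/
def wres (M : ℕ) (u : Fin n → Bool) : ZMod M := ∑ i, if u i then (1 : ZMod M) else 0

/-- A WEIGHT-RESIDUE STRATEGY: cut `g` fires according to an arbitrary table `h g : ℤ/M → Bool` read at `|u| mod M`. -/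
def wStrat (h : Fin (n + 1) → ZMod M → Bool) : Fin (n + 1) → (Fin n → Bool) → Bool := fun g u => h g (wres M u)

/-- The constant strategy played on the fibre `|u| ≡ m`: the firing set `Y_m = {g : h g m}`. -/
def fibreY (h : Fin (n + 1) → ZMod M → Bool) (m : ZMod M) : Finset (Fin (n + 1)) := univ.filter fun g => h g m = true

omit [NeZero M] in
/-- On the fibre `|u| ≡ m (mod M)` a weight-residue strategy IS the constant strategy `Y_m`. -/
theorem ringWinU_wStrat_fibre (c : ℕ) (h : Fin (n + 1) → ZMod M → Bool) {u : Fin n → Bool} {m : ZMod M}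
    (hu : wres M u = m) :
    ringWinU c (wStrat h) u = ringWinU c (fun g _ => decide (g ∈ fibreY h m)) u := by
  refine Summit.QuantumAdvantage.AdviceFreeQNC0.UnreadTwist.ringWinU_congr fun g => ?_
  unfold wStrat fibreY
  rw [hu]
  simp

/-- The indicator of `x = 0` in `ℤ/M` through the characters: `[x = 0] = M⁻¹ Σ_j e_M(j·x)`. -/
theorem indicator_eq_char_sum (x : ZMod M) :
    (if x = 0 then (1 : ℂ) else 0) = ((M : ℂ))⁻¹ * ∑ j : ZMod M, (ZMod.stdAddChar (j * x) : ℂ) := by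
  classical
  rw [AddChar.sum_mulShift x (ZMod.isPrimitive_stdAddChar M), ZMod.card M]
  have hM : (M : ℂ) ≠ 0 := by exact_mod_cast NeZero.ne M
  split_ifs <;> simp [hM]

omit [NeZero M] in
/-- `j · (|u| mod M) = Σ_i [u_i]·j`. [bookkeeping] -/
theorem mul_wres (j : ZMod M) (u : Fin n → Bool) : j * wres M u = ∑ i : Fin n, if u i then j else 0 := by
  unfold wres
  rw [Finset.mul_sum]
  refine Finset.sum_congr rfl fun i _ => ?_
  split_ifs <;> simp

/-- **The fibre count through characters.**  For a constant strategy `Y` and a residue `m`,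
`#{u : |u| ≡ m, WIN_Y(u)} ≤ θ₀·2ⁿ/M + 3·cos(π/(3M))ⁿ·2ⁿ` whenever `#WIN_Y ≤ θ₀·2ⁿ` and `3 ∤ M`. -/
theorem card_fibre_win_le (hM3 : M.Coprime 3) (c : ℕ) (Y : Finset (Fin (n + 1))) (m : ZMod M) {θ₀ : ℝ}
    (hY : ((univ.filter fun u : Fin n → Bool => ringWinU c (fun g _ => decide (g ∈ Y)) u = true).card : ℝ) ≤
      θ₀ * (2 : ℝ) ^ n) :
    ((univ.filter fun u : Fin n → Bool =>
        ringWinU c (fun g _ => decide (g ∈ Y)) u = true ∧ wres M u = m).card : ℝ) ≤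
      θ₀ * (2 : ℝ) ^ n / M + 3 * Real.cos (Real.pi / (3 * M)) ^ n * (2 : ℝ) ^ n := by
  classical
  set ρ := Real.cos (Real.pi / (3 * M)) with hρ
  set W : (Fin n → Bool) → Prop := fun u => ringWinU c (fun g _ => decide (g ∈ Y)) u = true with hW
  have hMpos : (0 : ℝ) < M := by exact_mod_cast Nat.pos_of_ne_zero (NeZero.ne M)
  have hMC : (M : ℂ) ≠ 0 := by exact_mod_cast NeZero.ne M
  -- the twisted sums
  set T : ZMod M → ℂ := fun j => ∑ u : Fin n → Bool, (if W u then (1 : ℂ) else 0) *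
    (ZMod.stdAddChar (∑ i : Fin n, if u i then j else 0) : ℂ) with hT
  -- Step 1: the count as a character sum
  have hcount : (((univ.filter fun u : Fin n → Bool => W u ∧ wres M u = m).card : ℕ) : ℂ) =
      ((M : ℂ))⁻¹ * ∑ j : ZMod M, (ZMod.stdAddChar (-(j * m)) : ℂ) * T j := by
    rw [Finset.natCast_card_filter]
    have hu : ∀ u : Fin n → Bool, (if W u ∧ wres M u = m then (1 : ℂ) else 0) =
        (if W u then (1 : ℂ) else 0) * (((M : ℂ))⁻¹ * ∑ j : ZMod M, (ZMod.stdAddChar (j * (wres M u - m)) : ℂ)) := by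
      intro u
      rw [← indicator_eq_char_sum (wres M u - m)]
      by_cases h1 : W u <;> by_cases h2 : wres M u = m <;> simp [h1, h2, sub_eq_zero]
    simp_rw [hu]
    have hswap : (∑ u : Fin n → Bool, (if W u then (1 : ℂ) else 0) *
        (((M : ℂ))⁻¹ * ∑ j : ZMod M, (ZMod.stdAddChar (j * (wres M u - m)) : ℂ))) =
        ((M : ℂ))⁻¹ * ∑ j : ZMod M, ∑ u : Fin n → Bool, (if W u then (1 : ℂ) else 0) *
          (ZMod.stdAddChar (j * (wres M u - m)) : ℂ) := by
      rw [Finset.sum_comm, Finset.mul_sum]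
      refine Finset.sum_congr rfl fun u _ => ?_
      rw [Finset.mul_sum, Finset.mul_sum, Finset.mul_sum]
      refine Finset.sum_congr rfl fun j _ => ?_
      ring
    rw [hswap]
    congr 1
    refine Finset.sum_congr rfl fun j _ => ?_
    rw [hT, Finset.mul_sum]
    refine Finset.sum_congr rfl fun u _ => ?_
    rw [mul_sub, sub_eq_add_neg, AddChar.map_add_eq_mul, mul_wres]
    ring
  -- Step 2: the bounds on the twisted sums
  have hT0 : ‖T 0‖ ≤ θ₀ * (2 : ℝ) ^ n := by
    have h0 : T 0 = (((univ.filter fun u : Fin n → Bool => W u).card : ℕ) : ℂ) := by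
      rw [hT, Finset.natCast_card_filter]
      refine Finset.sum_congr rfl fun u _ => ?_
      have : (∑ i : Fin n, if u i then (0 : ZMod M) else 0) = 0 := by simp
      rw [this, AddChar.map_zero_eq_one, mul_one]
    rw [h0, Complex.norm_natCast]
    exact hY
  have hTj : ∀ j : ZMod M, j ≠ 0 → ‖T j‖ ≤ 3 * ρ ^ n * (2 : ℝ) ^ n := fun j hj =>
    TwistM.corr_win_weight_le hM3 c Y hj
  have hTall : ∀ j : ZMod M, ‖(ZMod.stdAddChar (-(j * m)) : ℂ) * T j‖ ≤
      (if j = 0 then θ₀ * (2 : ℝ) ^ n else 0) + 3 * ρ ^ n * (2 : ℝ) ^ n := by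
    intro j
    rw [norm_mul, ZMod.stdAddChar_apply, Circle.norm_coe, one_mul]
    have hρn : 0 ≤ 3 * ρ ^ n * (2 : ℝ) ^ n := by
      have := TwistM.cos_nonneg M
      positivity
    by_cases hj : j = 0
    · rw [if_pos hj, hj]; linarith
    · rw [if_neg hj]; linarith [hTj j hj]
  -- Step 3: assemble
  have hsum : ‖∑ j : ZMod M, (ZMod.stdAddChar (-(j * m)) : ℂ) * T j‖ ≤ θ₀ * (2 : ℝ) ^ n + M * (3 * ρ ^ n * (2 : ℝ) ^ n) := by
    refine (norm_sum_le _ _).trans ?_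
    refine (Finset.sum_le_sum fun j _ => hTall j).trans ?_
    rw [Finset.sum_add_distrib, Finset.sum_ite_eq' univ (0 : ZMod M), if_pos (Finset.mem_univ _),
      Finset.sum_const, Finset.card_univ, ZMod.card M, nsmul_eq_mul]
  have hreal : (((univ.filter fun u : Fin n → Bool => W u ∧ wres M u = m).card : ℕ) : ℝ) =
      ‖(((univ.filter fun u : Fin n → Bool => W u ∧ wres M u = m).card : ℕ) : ℂ)‖ := by
    rw [Complex.norm_natCast]
  rw [hreal, hcount, norm_mul, norm_inv, Complex.norm_natCast]
  calc (M : ℝ)⁻¹ * ‖∑ j : ZMod M, (ZMod.stdAddChar (-(j * m)) : ℂ) * T j‖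
      ≤ (M : ℝ)⁻¹ * (θ₀ * (2 : ℝ) ^ n + M * (3 * ρ ^ n * (2 : ℝ) ^ n)) :=
        mul_le_mul_of_nonneg_left hsum (by positivity)
    _ = θ₀ * (2 : ℝ) ^ n / M + 3 * ρ ^ n * (2 : ℝ) ^ n := by
        field_simp

/-- **MAIN THEOREM (field-free).**  For every modulus `M` coprime to `3` and every constant-strategy bound `θ₀`
(`#WIN_Y ≤ θ₀·2ⁿ` for all firing sets `Y` at this `n`, `c`), every weight-residue strategy `y_g(u) = h_g(|u| mod M)` wins
the odd-`n` walk game on at most `(θ₀ + 3M·cos(π/(3M))ⁿ)·2ⁿ` inputs. -/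
theorem card_win_wStrat_le_of (hM3 : M.Coprime 3) (c : ℕ) {θ₀ : ℝ}
    (hconst : ∀ Y : Finset (Fin (n + 1)),
      ((univ.filter fun u : Fin n → Bool => ringWinU c (fun g _ => decide (g ∈ Y)) u = true).card : ℝ) ≤ θ₀ * (2 : ℝ) ^ n)
    (h : Fin (n + 1) → ZMod M → Bool) :
    ((univ.filter fun u : Fin n → Bool => ringWinU c (wStrat h) u = true).card : ℝ) ≤
      (θ₀ + 3 * M * Real.cos (Real.pi / (3 * M)) ^ n) * (2 : ℝ) ^ n := by
  classical
  have hsplit := Finset.card_eq_sum_card_fiberwise (f := wres M) (s := univ.filter fun u : Fin n → Bool =>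
    ringWinU c (wStrat h) u = true) (t := (univ : Finset (ZMod M))) (fun _ _ => Finset.mem_univ _)
  have hfib : ∀ m : ZMod M, ((univ.filter fun u : Fin n → Bool => ringWinU c (wStrat h) u = true).filter
      fun u => wres M u = m) = univ.filter fun u : Fin n → Bool =>
        ringWinU c (fun g _ => decide (g ∈ fibreY h m)) u = true ∧ wres M u = m := by
    intro m
    rw [Finset.filter_filter]
    refine Finset.filter_congr fun u _ => ?_
    constructor
    · rintro ⟨hw, hm⟩; exact ⟨(ringWinU_wStrat_fibre c h hm) ▸ hw, hm⟩
    · rintro ⟨hw, hm⟩; exact ⟨(ringWinU_wStrat_fibre c h hm).symm ▸ hw, hm⟩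
  rw [hsplit]
  push_cast
  calc (∑ m : ZMod M, ((((univ.filter fun u : Fin n → Bool => ringWinU c (wStrat h) u = true).filter
          fun u => wres M u = m).card : ℕ) : ℝ))
      ≤ ∑ m : ZMod M, (θ₀ * (2 : ℝ) ^ n / M + 3 * Real.cos (Real.pi / (3 * M)) ^ n * (2 : ℝ) ^ n) := by
        refine Finset.sum_le_sum fun m _ => ?_
        rw [hfib m]
        exact card_fibre_win_le hM3 c (fibreY h m) m (hconst _)
    _ = (θ₀ + 3 * M * Real.cos (Real.pi / (3 * M)) ^ n) * (2 : ℝ) ^ n := by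
        rw [Finset.sum_const, Finset.card_univ, ZMod.card M, nsmul_eq_mul]
        have hM : (M : ℝ) ≠ 0 := by exact_mod_cast NeZero.ne M
        field_simp

/-- **Corollary (`θ₀ = 3/4` from the landed hidden-coins lemma `J_4`).**  For `3 ∤ M`, `n ≥ 4`, every charge and every table,
`#WIN(y_h) ≤ (3/4 + 3M·cos(π/(3M))ⁿ)·2ⁿ`. -/
theorem card_win_wStrat_le (hM3 : M.Coprime 3) (hn : 4 ≤ n) (c : ℕ) (h : Fin (n + 1) → ZMod M → Bool) :
    ((univ.filter fun u : Fin n → Bool => ringWinU c (wStrat h) u = true).card : ℝ) ≤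
      (3 / 4 + 3 * M * Real.cos (Real.pi / (3 * M)) ^ n) * (2 : ℝ) ^ n := by
  refine card_win_wStrat_le_of hM3 c (fun Y => ?_) h
  have hJ := hiddenCoinsFour n c (∅ : Finset (Fin n)) (by simp; omega) (fun g _ => decide (g ∈ Y))
    (fun _ _ _ _ => rfl)
  exact hJ

end WeightResidue

/-! ## §3  Rung currency: the polylogarithmic scale and the constant `7/8` -/

section Asymptotics

/-- `cos(π/(3M)) ≤ 1 − 1/(4M²)` for every `M ≥ 1`. -/
theorem cos_le_one_sub (M : ℕ) (hM : 1 ≤ M) : Real.cos (Real.pi / (3 * M)) ≤ 1 - 1 / (4 * (M : ℝ) ^ 2) := by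
  rcases Nat.eq_or_lt_of_le hM with h1 | h2
  · -- `M = 1`: `cos(π/3) = 1/2`
    rw [← h1]
    norm_num [Real.cos_pi_div_three]
  · -- `M ≥ 2`: Taylor bound `cos x ≤ 1 − x²/2 + (5/96)x⁴`, `x = π/(3M) ≤ 1`, `x² ≥ 1/M²`
    have hM2 : (2 : ℝ) ≤ M := by exact_mod_cast h2
    have hMpos : (0 : ℝ) < M := by linarith
    set x : ℝ := Real.pi / (3 * M) with hx
    have hxpos : 0 < x := by rw [hx]; positivity
    have hx1 : x ≤ 1 := by
      rw [hx, div_le_one (by positivity)]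
      nlinarith [Real.pi_lt_four]
    have hxabs : |x| = x := abs_of_pos hxpos
    have hb := Real.cos_bound (x := x) (by rw [hxabs]; exact hx1)
    rw [hxabs] at hb
    have hcos : Real.cos x ≤ 1 - x ^ 2 / 2 + x ^ 4 * (5 / 96) := by
      have := (abs_le.1 hb).2
      linarith
    have hx2le : x ^ 2 ≤ 1 := by nlinarith
    have hx4 : x ^ 4 ≤ x ^ 2 := by
      calc x ^ 4 = x ^ 2 * x ^ 2 := by ring
        _ ≤ x ^ 2 * 1 := mul_le_mul_of_nonneg_left hx2le (sq_nonneg x)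
        _ = x ^ 2 := mul_one _
    have hpi2 : 9 < Real.pi ^ 2 := by nlinarith [Real.pi_gt_three, Real.pi_pos]
    have hxM : x * (3 * M) = Real.pi := by rw [hx]; field_simp
    have hsq : x ^ 2 * (9 * (M : ℝ) ^ 2) = Real.pi ^ 2 := by rw [← hxM]; ring
    have hx2 : 1 / (4 * (M : ℝ) ^ 2) ≤ x ^ 2 / 4 := by
      rw [div_le_div_iff₀ (by positivity) (by norm_num)]
      nlinarith [hsq, hpi2]
    nlinarith [hcos, hx4, hx2, sq_nonneg x]

/-- The twist term is at most `12M³/n`: `3M·cos(π/(3M))ⁿ ≤ 12M³/n` (`M, n ≥ 1`). -/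
theorem twist_term_le (M n : ℕ) (hM : 1 ≤ M) (hn : 1 ≤ n) :
    3 * (M : ℝ) * Real.cos (Real.pi / (3 * M)) ^ n ≤ 12 * (M : ℝ) ^ 3 / n := by
  have hMr : (1 : ℝ) ≤ M := by exact_mod_cast hM
  have hnr : (1 : ℝ) ≤ n := by exact_mod_cast hn
  haveI : NeZero M := ⟨by omega⟩
  have hc0 : 0 ≤ Real.cos (Real.pi / (3 * M)) := TwistM.cos_nonneg M
  set t : ℝ := 1 / (4 * (M : ℝ) ^ 2) with ht
  have ht0 : 0 ≤ t := by positivity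
  have ht1 : t ≤ 1 := by
    rw [ht, div_le_one (by positivity)]; nlinarith
  have h1 : Real.cos (Real.pi / (3 * M)) ^ n ≤ (1 - t) ^ n :=
    pow_le_pow_left₀ hc0 (cos_le_one_sub M hM) n
  have h2 : (1 - t) ^ n ≤ 1 / (1 + n * t) := Literature.Computability.Complexity.GabberGalil.one_sub_pow_le ht0 ht1 n
  have h3 : 1 / (1 + (n : ℝ) * t) ≤ 4 * (M : ℝ) ^ 2 / n := by
    rw [ht, div_le_div_iff₀ (by positivity) (by positivity)]
    have : (n : ℝ) * (1 / (4 * (M : ℝ) ^ 2)) * (4 * (M : ℝ) ^ 2) = n := by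
      field_simp
    nlinarith [this]
  calc 3 * (M : ℝ) * Real.cos (Real.pi / (3 * M)) ^ n ≤ 3 * (M : ℝ) * (4 * (M : ℝ) ^ 2 / n) := by
        refine mul_le_mul_of_nonneg_left (h1.trans (h2.trans h3)) (by positivity)
    _ = 12 * (M : ℝ) ^ 3 / n := by ring

/-- **At the polylogarithmic scale the twist term dies**: for `M ≤ (log₂ n)^C` and `n ≥ n₀(C)`, `3M·cos(π/(3M))ⁿ ≤ 1/8`. -/
theorem twist_small (C : ℕ) : ∃ n₀ : ℕ, ∀ n ≥ n₀, ∀ M : ℕ, 1 ≤ M → M ≤ (Nat.log 2 n) ^ C →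
    3 * (M : ℝ) * Real.cos (Real.pi / (3 * M)) ^ n ≤ 1 / 8 := by
  obtain ⟨N₀, hN₀⟩ := Summit.QuantumAdvantage.AdviceFreeQNC0.DWalk.const_mul_logPow_le' 96 (3 * C)
  refine ⟨max N₀ 1, fun n hn M hM hMle => ?_⟩
  have hn1 : 1 ≤ n := le_trans (le_max_right _ _) hn
  have h96 : 96 * M ^ 3 ≤ n := by
    have hM3 : M ^ 3 ≤ (Nat.log 2 n) ^ (3 * C) := by
      rw [pow_mul']
      exact Nat.pow_le_pow_left hMle 3
    calc 96 * M ^ 3 ≤ 96 * (Nat.log 2 n) ^ (3 * C) := Nat.mul_le_mul_left _ hM3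
      _ ≤ n := hN₀ n (le_trans (le_max_left _ _) hn)
  have h96r : 96 * (M : ℝ) ^ 3 ≤ n := by exact_mod_cast h96
  have hnr : (0 : ℝ) < n := by exact_mod_cast hn1
  calc 3 * (M : ℝ) * Real.cos (Real.pi / (3 * M)) ^ n ≤ 12 * (M : ℝ) ^ 3 / n := twist_term_le M n hM hn1
    _ ≤ 1 / 8 := by
        rw [div_le_div_iff₀ hnr (by norm_num)]
        linarith

end Asymptotics

section Rung

/-- **Weight-residue strategies lose at the polylogarithmic scale** (rung currency, the quantifier shape of `WalkHardF`,
`θ = 7/8`): for every `C` and `n ≥ n₀(C)`, every charge, every modulus `0 < M ≤ (log₂ n)^C` coprime to `3` and every table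
`h`, the strategy `y_g(u) = h_g(|u| mod M)` wins the u-walk game on at most `(7/8)·2ⁿ` inputs. -/
theorem card_win_wStrat_le_polylog (C : ℕ) : ∃ n₀ : ℕ, ∀ n ≥ n₀, ∀ c : ℕ, ∀ (M : ℕ) [NeZero M], M.Coprime 3 →
    M ≤ (Nat.log 2 n) ^ C → ∀ h : Fin (n + 1) → ZMod M → Bool,
      ((univ.filter fun u : Fin n → Bool => ringWinU c (wStrat h) u = true).card : ℝ) ≤ (7 / 8) * (2 : ℝ) ^ n := by
  obtain ⟨n₁, hn₁⟩ := twist_small C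
  refine ⟨max n₁ 4, fun n hn c M _ hM3 hMle h => ?_⟩
  have h4 : 4 ≤ n := le_trans (le_max_right _ _) hn
  have hM1 : 1 ≤ M := Nat.one_le_iff_ne_zero.2 (NeZero.ne M)
  have ht := hn₁ n (le_trans (le_max_left _ _) hn) M hM1 hMle
  have hmain := card_win_wStrat_le hM3 h4 c h
  have h2n : (0 : ℝ) ≤ (2 : ℝ) ^ n := by positivity
  nlinarith

end Rung

end Summit.QuantumAdvantage.QuantumAdvantage.Theorems.DigitDial
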